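import Summits.CriticalPhenomena.SAWScalingLimit.Theses.SAWMassiveIsingTilt
import Summits.CriticalPhenomena.SAWScalingLimit.Theorems.SAWMassiveIsingTiltDefs
import Summits.CriticalPhenomena.SAWScalingLimit.Theorems.SAWMassiveIsingTiltMassiveWindowSLEStubIsingTwoPointLocality
import Summits.CriticalPhenomena.SAWScalingLimit.Theorems.SAWDefectDecoherenceBoundaryClosureRZigzagDiscretisationWalks
import HarnessLib

/-!
# Crux `MassiveWindowSLE` (stmt-CriticalPhenomena-7685), line `registered`, skeleton r8 —
# stub F1 `stub_zloopMixingEdgeBound`: the per-edge estimate of the ratio-mixing engine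

Route `route-CriticalPhenomena-SAWMassiveIsingTilt` (CriticalPhenomena / SAWScalingLimit). The engine
of the line (RATE-form window ratio mixing of the loop-gas bath, proved in r7 in the implication form
`GEO → ALG → ISING → M''`) is re-cut in r8 into three hypothesis-free registered pieces landing in
sequence: F1 (this file, one attachment edge), F2 `stub_zloopRatioMixingCore` (fixed-mesh core:
decomposition, telescoping, counting) and F3 `stub_zloopRateRatioMixing` (M'', the eventual
statement along fast RATE-schedules). `Zloop H S y` (`Theorems/SAWMassiveIsingTiltDefs.lean`) is the
loop-`O(1)` (high-temperature Ising) partition function of `H` read inside `S`; the two-point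
numerator `W_H(S; u, v)(t)` (sum of `t ^ |E|` over the finite edge sets of `H` inside `S` with odd
vertices exactly `u, v`) is written with the parse-time notation `W⟦H, S, u, v, t⟧`, which expands to
the finsum spelled out in the registered signatures.

**F1.** For a subgraph `G ≤ hexGraph` with finitely many edges read inside two vertex sets `S₁, S₂`
that both contain the honeycomb ball `B` of radius `ρ ≥ 4` (in centre distance) about a honeycomb
edge `{u, v}`, the loop two-point ratios at `y = tanh β` (`0 ≤ β ≤ 1`) satisfy
`|W/Zloop(G, S₁; u, v) − W/Zloop(G, S₂; u, v)| ≤ 18 (C₀(ρ+1)²)² e^{-c ρ/2}`, given the counting bound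
`#(ball of radius ρ) ≤ C₀(ρ+1)²` and the RATE bound `W_Λ(u, x) ≤ e^{-c·dist} Zloop_Λ` at weight `y`.
Proof: the landed locality stub MIsing (`stub_isingTwoPointLocality`, GKS/GHS) with `H₁ = H₂ = G`,
`B` = the ball, `Bd` = its outer unit shell `{ρ − 1 < dist ≤ ρ}` bounds the difference by
`9β² · #B · Σ_{x ∈ Bd} (W_B(u, x) + W_B(v, x))/Zloop_B`; every `x ∈ Bd` is at distance `≥ ρ/2` from
`u` and from `v`, so RATE bounds each summand by `2 e^{-c ρ/2}`, and `#Bd ≤ #B ≤ C₀(ρ+1)²`.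
General helpers (`mix_*`: finiteness of the summation families, `1 ≤ Zloop`, `0 ≤ W`) are reused by
F2 and F3; adjacent honeycomb centres are at distance `< 1` (`dist_hexCenter_lt_one_of_adj`,
`Theorems/SAWDefectDecoherenceBoundaryClosureRZigzagDiscretisationWalks.lean`).

References: S. Friedli, Y. Velenik, *Statistical Mechanics of Lattice Systems* (CUP 2017), §3.7
(high-temperature representation, `tanh β` weights) [FriedliVelenik2017]; G. F. Lawler, O. Schramm,
W. Werner, *Conformal restriction: the chordal case*, J. Amer. Math. Soc. 16 (2003) 917–955, §3
[LawlerSchrammWerner2003Restriction]. No new facts are cited.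
-/

noncomputable section

namespace Summit.CriticalPhenomena.SAWScalingLimit.Theorems.MassiveWindowSLE.Birth

open scoped BigOperators Topology Classical MeasureTheory NNReal ENNReal
open Filter Set MeasureTheory
open Literature.Probability Literature.Probability.LatticeModels Literature.Probability.RandomPlanarGeometry
open Summit.CriticalPhenomena.SAWScalingLimit.Theorems.SAWMassiveIsingTilt
open Summit.CriticalPhenomena.SAWScalingLimit.Theorems.PolygonParitySqueeze.ZigzagDiscretisation
  (dist_hexCenter_lt_one_of_adj)

/-- `W⟦H, S, u, v, t⟧`: parse-time notation for the loop-gas two-point numerator `W_H(S; u, v)(t)` —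
the sum over the finite edge sets of `H` inside `S` whose odd-degree vertices are exactly `u, v` of
`t ^ |E|` (it expands to the very finsum spelled out in the registered signatures). -/
local notation3 (prettyPrint := false) "W⟦" H ", " S ", " u ", " v ", " t "⟧" =>
  (∑ᶠ E ∈ {E : Finset (Sym2 Literature.Probability.LatticeModels.HexVertex) |
    (∀ e ∈ E, e ∈ (H).edgeSet ∧ ∀ w ∈ e, w ∈ S) ∧
      ∀ w : Literature.Probability.LatticeModels.HexVertex,
        (Odd (E.filter (fun e => w ∈ e)).card ↔ (w = u ∨ w = v))}, t ^ E.card)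

/-! ### General facts on `Zloop` and `W` -/

/-- The edges of any graph inside a finite vertex set `↑B` form a finite set. -/
theorem mix_finite_edges_of_finset (H : SimpleGraph HexVertex) (B : Finset HexVertex) :
    {e : Sym2 HexVertex | e ∈ H.edgeSet ∧ ∀ w ∈ e, w ∈ (↑B : Set HexVertex)}.Finite := by
  refine ((B ×ˢ B).image fun p : HexVertex × HexVertex => s(p.1, p.2)).finite_toSet.subset ?_
  intro e he
  induction e using Sym2.ind with
  | h a b =>
    exact Finset.mem_coe.2 (Finset.mem_image.2 ⟨(a, b),
      Finset.mem_product.2 ⟨he.2 a (Sym2.mem_mk_left a b), he.2 b (Sym2.mem_mk_right a b)⟩, rfl⟩)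

/-- Finiteness of the families of admissible edge sets summed over in `Zloop` and `W`. -/
theorem mix_finite_family {H : SimpleGraph HexVertex} {S : Set HexVertex}
    (h : {e : Sym2 HexVertex | e ∈ H.edgeSet ∧ ∀ w ∈ e, w ∈ S}.Finite)
    (P : Finset (Sym2 HexVertex) → Prop) :
    {E : Finset (Sym2 HexVertex) | (∀ e ∈ E, e ∈ H.edgeSet ∧ ∀ w ∈ e, w ∈ S) ∧ P E}.Finite := by
  refine (h.finite_subsets.preimage Finset.coe_injective.injOn).subset ?_
  intro E hE
  simp only [Set.mem_preimage, Set.mem_setOf_eq, Set.subset_def, Finset.mem_coe]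
  exact fun e he => hE.1 e he

/-- `1 ≤ Zloop(H, S; y)` for `y ≥ 0` whenever the admissible edges are finitely many (the empty
subgraph contributes `1`, all terms are `≥ 0`). -/
theorem mix_one_le_zloop {H : SimpleGraph HexVertex} {S : Set HexVertex}
    (h : {e : Sym2 HexVertex | e ∈ H.edgeSet ∧ ∀ w ∈ e, w ∈ S}.Finite) {y : ℝ} (hy : 0 ≤ y) :
    1 ≤ Zloop H S y := by
  unfold Zloop
  have hfin : {E : Finset (Sym2 HexVertex) | (∀ e ∈ E, e ∈ H.edgeSet ∧ ∀ v ∈ e, v ∈ S) ∧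
      ∀ v : HexVertex, Even (E.filter (fun e => v ∈ e)).card}.Finite :=
    mix_finite_family h _
  rw [finsum_mem_eq_finite_toFinset_sum _ hfin]
  have h0 : (∅ : Finset (Sym2 HexVertex)) ∈ hfin.toFinset := by
    rw [Set.Finite.mem_toFinset]
    simp
  calc (1 : ℝ) = y ^ (∅ : Finset (Sym2 HexVertex)).card := by simp
    _ ≤ ∑ E ∈ hfin.toFinset, y ^ E.card :=
        Finset.single_le_sum (fun E _ => pow_nonneg hy _) h0

/-- `0 ≤ W` for nonnegative weights. -/
theorem mix_W_nonneg (H : SimpleGraph HexVertex) (S : Set HexVertex) (u v : HexVertex) {t : ℝ}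
    (ht : 0 ≤ t) : 0 ≤ W⟦H, S, u, v, t⟧ :=
  finsum_nonneg fun _ => finsum_nonneg fun _ => pow_nonneg ht _

/-! ### The registered stub F1: MIsing + RATE in a honeycomb ball -/

/-- **Stub F1 `stub_zloopMixingEdgeBound` (one attachment edge).** For a subgraph `G ≤ hexGraph`
with finitely many edges, a honeycomb edge `uv`, a radius `ρ ≥ 4` such that every honeycomb vertex
within distance `ρ` of `u` lies in `S₁ ∩ S₂`, MIsing (`stub_isingTwoPointLocality` with
`H₁ = H₂ = G`, `B` = the ball of radius `ρ` about `u`, `Bd` = its outer unit shell) and RATE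
(boundary vertices are at distance `> ρ − 2 ≥ ρ/2` from `u` and `v`) give
`|W/Zloop(G, S₁; u, v) − W/Zloop(G, S₂; u, v)| ≤ 9β²·#B·#Bd·2e^{-c ρ/2} ≤ 18 (C₀(ρ+1)²)² e^{-c ρ/2}`
(`y = tanh β`, `0 ≤ β ≤ 1`, `#Bd ≤ #B ≤ C₀(ρ+1)²` by the counting bound). -/
theorem stub_zloopMixingEdgeBound :
    ∀ (C₀ : ℝ), (∀ (z : ℂ) (ρ : ℝ), 0 ≤ ρ → {w : Literature.Probability.LatticeModels.HexVertex | dist (Literature.Probability.LatticeModels.hexCenter w) z ≤ ρ}.Finite ∧ (({w : Literature.Probability.LatticeModels.HexVertex | dist (Literature.Probability.LatticeModels.hexCenter w) z ≤ ρ}.ncard : ℝ) ≤ C₀ * (ρ + 1) ^ 2)) → ∀ (y cδ : ℝ), 0 ≤ y → (∀ (Λ : Finset Literature.Probability.LatticeModels.HexVertex) (u v : Literature.Probability.LatticeModels.HexVertex), u ∈ Λ → v ∈ Λ → u ≠ v → (∑ᶠ E ∈ {E : Finset (Sym2 Literature.Probability.LatticeModels.HexVertex) | (∀ e ∈ E,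 e ∈ (Literature.Probability.LatticeModels.hexGraph).edgeSet ∧ ∀ w ∈ e, w ∈ (↑Λ : Set Literature.Probability.LatticeModels.HexVertex)) ∧ ∀ w : Literature.Probability.LatticeModels.HexVertex, (Odd (E.filter (fun e => w ∈ e)).card ↔ (w = u ∨ w = v))}, y ^ E.card) ≤ Real.exp (-(cδ * dist (Literature.Probability.LatticeModels.hexCenter u) (Literature.Probability.LatticeModels.hexCenter v))) * Summit.CriticalPhenomena.SAWScalingLimit.Theorems.SAWMassiveIsingTilt.Zloop Literature.Probability.LatticeModels.hexGraph (↑Λ : Set Literature.Probability.LatticeModels.HexVertex) y) → 0 ≤ cδ → ∀ (β : ℝ), 0 ≤ β → β ≤ 1 → Real.tanh β = y → ∀ (G : SimpleGraph Literature.Probability.LatticeModels.HexVertex), G ≤ Literature.Probability.LatticeModels.hexGraph → G.edgeSet.Finite → ∀ (S₁ S₂ : Set Literature.Probability.LatticeModels.HexVertex) (ρ : ℝ), 4 ≤ ρ → ∀ (u v : Literature.Probability.LatticeModels.HexVertex), Literature.Probability.LatticeModels.hexGraph.Adj u v → (∀ x : Literature.Probability.LatticeModels.HexVertex, dist (Literature.Probability.LatticeModels.hexCenter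 x) (Literature.Probability.LatticeModels.hexCenter u) ≤ ρ → x ∈ S₁ ∧ x ∈ S₂) → |(∑ᶠ E ∈ {E : Finset (Sym2 Literature.Probability.LatticeModels.HexVertex) | (∀ e ∈ E, e ∈ (G).edgeSet ∧ ∀ w ∈ e, w ∈ S₁) ∧ ∀ w : Literature.Probability.LatticeModels.HexVertex, (Odd (E.filter (fun e => w ∈ e)).card ↔ (w = u ∨ w = v))}, y ^ E.card) / Summit.CriticalPhenomena.SAWScalingLimit.Theorems.SAWMassiveIsingTilt.Zloop G S₁ y - (∑ᶠ E ∈ {E : Finset (Sym2 Literature.Probability.LatticeModels.HexVertex) | (∀ e ∈ E, e ∈ (G).edgeSet ∧ ∀ w ∈ e, w ∈ S₂) ∧ ∀ w : Literature.Probability.LatticeModels.HexVertex, (Odd (E.filter (fun e => w ∈ e)).card ↔ (w = u ∨ w = v))}, y ^ E.card) / Summit.CriticalPhenomena.SAWScalingLimit.Theorems.SAWMassiveIsingTilt.Zloop G S₂ y| ≤ 18 * (C₀ * (ρ + 1) ^ 2) ^ 2 * Real.exp (-(cδ * (ρ / 2))) := by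
  intro C₀ hC₀ y cδ hy hrate hc β hβ0 hβ1 hβy G hGle hGfin S₁ S₂ ρ hρ u v huv hS
  obtain ⟨hBfin, hBcard⟩ := hC₀ (hexCenter u) ρ (by linarith)
  set B : Finset HexVertex := hBfin.toFinset with hBdef
  have hmemB : ∀ x, x ∈ B ↔ dist (hexCenter x) (hexCenter u) ≤ ρ := fun x => by
    rw [hBdef, Set.Finite.mem_toFinset]
    rfl
  set Bd : Finset HexVertex := B.filter (fun x => ρ - 1 < dist (hexCenter x) (hexCenter u))
    with hBddef
  have hmemBd : ∀ x, x ∈ Bd ↔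
      dist (hexCenter x) (hexCenter u) ≤ ρ ∧ ρ - 1 < dist (hexCenter x) (hexCenter u) := fun x => by
    rw [hBddef, Finset.mem_filter, hmemB]
  have hdvu : dist (hexCenter v) (hexCenter u) < 1 := by
    rw [dist_comm]
    exact dist_hexCenter_lt_one_of_adj huv
  have huB : u ∈ B := (hmemB u).2 (by rw [dist_self]; linarith)
  have hvB : v ∈ B := (hmemB v).2 (by linarith)
  have huBd : u ∉ Bd := fun h => by
    have := ((hmemBd u).1 h).2
    rw [dist_self] at this
    linarith
  have hvBd : v ∉ Bd := fun h => by
    have := ((hmemBd v).1 h).2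
    linarith
  have hB1 : (↑B : Set HexVertex) ⊆ S₁ := fun x hx => (hS x ((hmemB x).1 (Finset.mem_coe.1 hx))).1
  have hB2 : (↑B : Set HexVertex) ⊆ S₂ := fun x hx => (hS x ((hmemB x).1 (Finset.mem_coe.1 hx))).2
  have hbdry : ∀ x ∈ B, ∀ w : HexVertex, hexGraph.Adj x w → w ∉ B → x ∈ Bd := by
    intro x hx w hxw hw
    rw [hmemB] at hx
    rw [hmemB, not_le] at hw
    refine (hmemBd x).2 ⟨hx, ?_⟩
    have h1 := dist_hexCenter_lt_one_of_adj hxw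
    have htri := dist_triangle (hexCenter w) (hexCenter x) (hexCenter u)
    rw [dist_comm] at h1
    linarith
  have hcardB : (B.card : ℝ) ≤ C₀ * (ρ + 1) ^ 2 := by
    rw [hBdef, ← Set.ncard_eq_toFinset_card _ hBfin]
    exact hBcard
  have hcardBd : (Bd.card : ℝ) ≤ C₀ * (ρ + 1) ^ 2 :=
    le_trans (by exact_mod_cast Finset.card_filter_le _ _) hcardB
  have hI := stub_isingTwoPointLocality β hβ0 G G hGle hGle hGfin hGfin S₁ S₂ B Bd u v huv.ne huB
    hvB huBd hvBd hB1 hB2 hbdry (fun _ _ _ _ => Iff.rfl)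
  rw [hβy] at hI
  refine hI.trans ?_
  have hZB : 1 ≤ Zloop hexGraph (↑B : Set HexVertex) y :=
    mix_one_le_zloop (mix_finite_edges_of_finset hexGraph B) hy
  have hZpos : 0 < Zloop hexGraph (↑B : Set HexVertex) y := by linarith
  have hterm : ∀ x ∈ Bd, (W⟦hexGraph, (↑B : Set HexVertex), u, x, y⟧ +
      W⟦hexGraph, (↑B : Set HexVertex), v, x, y⟧) /
      Zloop hexGraph (↑B : Set HexVertex) y ≤ 2 * Real.exp (-(cδ * (ρ / 2))) := by
    intro x hx
    obtain ⟨hxB', hxfar⟩ := (hmemBd x).1 hx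
    have hxB : x ∈ B := (hmemB x).2 hxB'
    have hux : u ≠ x := fun h => huBd (h ▸ hx)
    have hvx : v ≠ x := fun h => hvBd (h ▸ hx)
    have h1 := hrate B u x huB hxB hux
    have h2 := hrate B v x hvB hxB hvx
    have hdux : ρ / 2 ≤ dist (hexCenter u) (hexCenter x) := by
      rw [dist_comm]
      linarith
    have hdvx : ρ / 2 ≤ dist (hexCenter v) (hexCenter x) := by
      have := dist_triangle (hexCenter x) (hexCenter v) (hexCenter u)
      rw [dist_comm (hexCenter x) (hexCenter v)] at this
      linarith
    have he1 : Real.exp (-(cδ * dist (hexCenter u) (hexCenter x))) ≤ Real.exp (-(cδ * (ρ / 2))) :=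
      Real.exp_le_exp.2 (neg_le_neg (mul_le_mul_of_nonneg_left hdux hc))
    have he2 : Real.exp (-(cδ * dist (hexCenter v) (hexCenter x))) ≤ Real.exp (-(cδ * (ρ / 2))) :=
      Real.exp_le_exp.2 (neg_le_neg (mul_le_mul_of_nonneg_left hdvx hc))
    rw [div_le_iff₀ hZpos]
    calc W⟦hexGraph, (↑B : Set HexVertex), u, x, y⟧ + W⟦hexGraph, (↑B : Set HexVertex), v, x, y⟧
        ≤ Real.exp (-(cδ * dist (hexCenter u) (hexCenter x))) * Zloop hexGraph ↑B y +
            Real.exp (-(cδ * dist (hexCenter v) (hexCenter x))) * Zloop hexGraph ↑B y :=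
          add_le_add h1 h2
      _ ≤ Real.exp (-(cδ * (ρ / 2))) * Zloop hexGraph ↑B y +
            Real.exp (-(cδ * (ρ / 2))) * Zloop hexGraph ↑B y :=
          add_le_add (mul_le_mul_of_nonneg_right he1 hZpos.le)
            (mul_le_mul_of_nonneg_right he2 hZpos.le)
      _ = 2 * Real.exp (-(cδ * (ρ / 2))) * Zloop hexGraph ↑B y := by ring
  have hsum := Finset.sum_le_card_nsmul Bd _ _ hterm
  rw [nsmul_eq_mul] at hsum
  have hsum0 : 0 ≤ ∑ x ∈ Bd, (W⟦hexGraph, (↑B : Set HexVertex), u, x, y⟧ +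
      W⟦hexGraph, (↑B : Set HexVertex), v, x, y⟧) / Zloop hexGraph (↑B : Set HexVertex) y :=
    Finset.sum_nonneg fun x _ => div_nonneg
      (add_nonneg (mix_W_nonneg _ _ _ _ hy) (mix_W_nonneg _ _ _ _ hy)) hZpos.le
  have hβ2 : β ^ 2 ≤ 1 := pow_le_one₀ hβ0 hβ1
  have hC₀ρ : 0 ≤ C₀ * (ρ + 1) ^ 2 := le_trans (Nat.cast_nonneg _) hcardB
  have hE0 : 0 ≤ 2 * Real.exp (-(cδ * (ρ / 2))) := by positivity
  calc 9 * β ^ 2 * (B.card : ℝ) * ∑ x ∈ Bd, (W⟦hexGraph, (↑B : Set HexVertex), u, x, y⟧ +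
          W⟦hexGraph, (↑B : Set HexVertex), v, x, y⟧) / Zloop hexGraph (↑B : Set HexVertex) y
      ≤ 9 * 1 * (C₀ * (ρ + 1) ^ 2) * ((Bd.card : ℝ) * (2 * Real.exp (-(cδ * (ρ / 2))))) := by
        refine mul_le_mul ?_ hsum hsum0 (by linarith)
        refine mul_le_mul ?_ hcardB (Nat.cast_nonneg _) (by norm_num)
        exact mul_le_mul_of_nonneg_left hβ2 (by norm_num)
    _ ≤ 9 * 1 * (C₀ * (ρ + 1) ^ 2) * ((C₀ * (ρ + 1) ^ 2) * (2 * Real.exp (-(cδ * (ρ / 2))))) := by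
        refine mul_le_mul_of_nonneg_left ?_ (by linarith)
        exact mul_le_mul_of_nonneg_right hcardBd hE0
    _ = 18 * (C₀ * (ρ + 1) ^ 2) ^ 2 * Real.exp (-(cδ * (ρ / 2))) := by ring

end Summit.CriticalPhenomena.SAWScalingLimit.Theorems.MassiveWindowSLE.Birth

end
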